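import Summits.HodgeConjecture.HodgeCM.Model.Toy.ToyPadH6Alg_1

/-! PORT of `HodgeCM/Model/Toy/ToyPadH6Alg.lean` (HodgeCMPerL run 82) — part 2: continuation of `Summits.HodgeConjecture.HodgeCM.Model.Toy.ToyPadH6Alg_1` (split at a top-level declaration boundary by port_pkg.py; scope re-opened below; declarations unchanged). -/

-- port_pkg: scope re-opened for this part (file-level context, then the namespace/section stack open at the cut)
noncomputable section
open scoped TensorProduct
namespace HodgeCM
open Literature.AlgebraicGeometry.Motives (CMType HodgeStructure)
open Literature.AlgebraicGeometry.Motives.HodgeStructure (ofRat pureFiltration)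
namespace Toy
open Universe
/-- **`pohlmann_span` is independent of the rest of the package's named statements, the target included**:
`ModelAxioms ∧ N2 ∧ N3 ∧ N4 ∧ F4 ∧ F5 ∧ Fact_dimProd ∧ W_RK4 ∧ Qw8Sufficiency ∧ HC_CM` has a model with
`PohlmannSpan` (`toyModel`) and one without (`padAlgModel`). -/
theorem pohlmannSpan_independent_of_rest :
    (∃ U : Universe, (U.ModelAxioms ∧ U.Fact_cup_hodge ∧ U.Fact_pull_H0 ∧ U.Fact_hodge_F0 ∧ U.Fact_cupAlg ∧
        U.Fact_cupAssoc ∧ U.Fact_dimProd ∧ U.W_RK4 ∧ U.Qw8Sufficiency ∧ U.HC_CM) ∧ U.PohlmannSpan) ∧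
      ∃ U : Universe, (U.ModelAxioms ∧ U.Fact_cup_hodge ∧ U.Fact_pull_H0 ∧ U.Fact_hodge_F0 ∧ U.Fact_cupAlg ∧
        U.Fact_cupAssoc ∧ U.Fact_dimProd ∧ U.W_RK4 ∧ U.Qw8Sufficiency ∧ U.HC_CM) ∧ ¬ U.PohlmannSpan :=
  ⟨⟨toyModel, ⟨toyModel_modelAxioms, toyModel_fact_cup_hodge, toyModel_fact_pull_H0, toyModel_fact_hodge_F0,
      fact_cupAlg, fact_cupAssoc exteriorHodgeData, toyModel_fact_dimProd, toyModel_w_rk4, toyModel_qw8Sufficiency,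
      toyModel_hc_cm⟩, toyModel_pohlmannSpan'⟩,
    ⟨padAlgModel, padAlgModel_profile.1.imp_right fun h => ⟨h.1, h.2.1, h.2.2.1, h.2.2.2.2.2.1, h.2.2.2.2.1,
      h.2.2.2.1, h.2.2.2.2.2.2.1, h.2.2.2.2.2.2.2.1, h.2.2.2.2.2.2.2.2.2⟩, not_padAlgModel_pohlmannSpan⟩⟩

/-- **COR-CM does not imply Pohlmann's span theorem** (over the 28 model facts): the input is not a consequence of
the conclusion. -/
theorem hc_cm_not_implies_pohlmannSpan : ¬ ∀ U : Universe, U.ModelAxioms → U.HC_CM → U.PohlmannSpan :=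
  fun h => not_padAlgModel_pohlmannSpan (h _ padAlgModel_modelAxioms padAlgModel_hc_cm)

/-- **COR-CM does not imply N1 `H^• = ⋀^• H¹`** (over the 28 model facts and N2–N4). -/
theorem hc_cm_not_implies_fact_cupExterior :
    ¬ ∀ U : Universe, U.ModelAxioms → U.Fact_cup_hodge → U.Fact_pull_H0 → U.Fact_hodge_F0 → U.HC_CM →
      U.Fact_cupExterior :=
  fun h => not_padAlgModel_fact_cupExterior
    (h _ padAlgModel_modelAxioms padAlgModel_fact_cup_hodge padAlgModel_fact_pull_H0 padAlgModel_fact_hodge_F0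
      padAlgModel_hc_cm)

/-- (Ported verbatim from the HodgeCMPerL package; no docstring in the source.) -/
theorem padAlgModel_ne_toyModel : padAlgModel ≠ toyModel := fun h =>
  not_padAlgModel_fact_cupExterior (h ▸ toyModel_fact_cupExterior)

/-- (Ported verbatim from the HodgeCMPerL package; no docstring in the source.) -/
theorem padAlgModel_ne_padModel : padAlgModel ≠ padModel := fun h => not_padModel_hc_cm (h ▸ padAlgModel_hc_cm)

/-- (Ported verbatim from the HodgeCMPerL package; no docstring in the source.) -/
theorem padAlgModel_ne_truncModel : padAlgModel ≠ truncModel := fun h =>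
  not_padAlgModel_fact_cupExterior (h ▸ truncModel_fact_cupExterior)

/-- Four pairwise distinct models of the 28 facts. -/
theorem exists_four_models :
    ∃ U₁ U₂ U₃ U₄ : Universe, U₁.ModelAxioms ∧ U₂.ModelAxioms ∧ U₃.ModelAxioms ∧ U₄.ModelAxioms ∧
      U₁ ≠ U₂ ∧ U₁ ≠ U₃ ∧ U₁ ≠ U₄ ∧ U₂ ≠ U₃ ∧ U₂ ≠ U₄ ∧ U₃ ≠ U₄ :=
  ⟨toyModel, truncModel, padModel, padAlgModel, toyModel_modelAxioms, truncModel_modelAxioms, padModel_modelAxioms,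
    padAlgModel_modelAxioms, truncModel_ne_toyModel.symm, padModel_ne_toyModel.symm, padAlgModel_ne_toyModel.symm,
    padModel_ne_truncModel.symm, padAlgModel_ne_truncModel.symm, padAlgModel_ne_padModel.symm⟩

end Toy

end HodgeCM

end
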